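import Summits.QuantumFields.QCD.Theorems.SpectralDefectExtinctionTipPricingWallBlockDecay

/-!
# Index equivalences for the modular cell–wall template (sub-goal B2 of crux stmt-QuantumFields-8967)

Bookkeeping lemmas of the modular cell–wall template (crux idea `Cruxes/TipPricing/Ideas/modular-cell-wall-template.md`,
lead c2; serves stub `stub_spreadOfCells` of line `hermitian-flow-coarea` r3 for crux `TipPricing`, where the big block of
the Wilson–Dirac operator over an embedded box is put in `Matrix.fromBlocks` / `Matrix.blockDiagonal` form).
Supports stmt-QuantumFields-8967 (helper; closes no item).

* `indexEquiv_exists_equiv_sum_compl` — the abstract split: an injective map `g : β → α` with image inside a predicate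
  `P`, and `Q` the image predicate of `g`, give `{a // P a} ≃ β ⊕ {a // P a ∧ ¬ Q a}` whose inverse is `inl b ↦ g b`,
  `inr w ↦ w`.
* `boxIdx_equiv_cells_sum_wall` (B2a) — the quark indices `TorusSite 4 n × Fin 3 × Fin 4` (site, colour, spin) over the
  big box `c + {−R..R}⁴` of the torus `ℤ_n⁴` (`2R+1 < n`) split as (abstract cell index `↥(box 4 ℓ) × Fin 3 × Fin 4` ×
  cell label `Fin N`) ⊕ (wall indices), for `N` pairwise disjoint cells `z k + {−ℓ..ℓ}⁴` inside the big box.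
* `cwcIdx_equiv_cell_sum_collar` (B2b) — the quark indices over one cell-with-collar `c + z₀ + {−(ℓ+W)..ℓ+W}⁴`
  (`2(ℓ+W)+1 < n`) split as (abstract cell index) ⊕ (collar indices).

Proof.  Both are instances of the abstract split; injectivity of the cell parametrisation is uniqueness of box
coordinates on the torus (`wallDecay_boxCoord_unique`: `y ↦ Torus.proj n (c + y)` is injective on `box 4 R` when
`2R+1 < n`) together with the disjointness of the cells.
-/

noncomputable section

namespace Summit.QuantumFields.QCD.Cruxes.TipPricing.ModularTemplate

open Matrix
open Literature.MathematicalPhysics.QuantumLattice Literature.MathematicalPhysics.QuantumFieldTheory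
  Literature.Probability.LatticeModels
open scoped BigOperators

variable {n : ℕ}

/-! ### The abstract split -/

/-- **Abstract index split.**  If `g : β → α` is injective with image inside the predicate `P`, and `Q` is the image
predicate of `g`, then `{a // P a} ≃ β ⊕ {a // P a ∧ ¬ Q a}`, the inverse equivalence sending `inl b ↦ g b` and
`inr w ↦ w`. -/
theorem indexEquiv_exists_equiv_sum_compl {α β : Type*} (P Q : α → Prop) (g : β → α) (hg : Function.Injective g)
    (hP : ∀ b, P (g b)) (hQ : ∀ a, Q a ↔ ∃ b, g b = a) :
    ∃ e : {a // P a} ≃ β ⊕ {a // P a ∧ ¬ Q a},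
      (∀ b, ((e.symm (Sum.inl b) : {a // P a}) : α) = g b) ∧
      (∀ w : {a // P a ∧ ¬ Q a}, ((e.symm (Sum.inr w) : {a // P a}) : α) = w.1) := by
  classical
  let f : β ⊕ {a // P a ∧ ¬ Q a} → {a // P a} := Sum.elim (fun b => ⟨g b, hP b⟩) fun w => ⟨w.1, w.2.1⟩
  have hf : Function.Bijective f := by
    refine ⟨?_, fun a => ?_⟩
    · rintro (b | w) (b' | w') h
      · exact congrArg Sum.inl (hg (congrArg Subtype.val h))
      · exact absurd ((hQ w'.1).2 ⟨b, congrArg Subtype.val h⟩) w'.2.2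
      · exact absurd ((hQ w.1).2 ⟨b', (congrArg Subtype.val h).symm⟩) w.2.2
      · exact congrArg Sum.inr (Subtype.ext (congrArg Subtype.val h :))
    · by_cases h : Q (a : α)
      · obtain ⟨b, hb⟩ := (hQ _).1 h
        exact ⟨Sum.inl b, Subtype.ext hb⟩
      · exact ⟨Sum.inr ⟨a, a.2, h⟩, rfl⟩
  exact ⟨(Equiv.ofBijective f hf).symm, fun b => rfl, fun w => rfl⟩

/-! ### The two index equivalences -/

/-- **B2a. Big-box index split.**  For disjoint cells `z k + {−ℓ..ℓ}⁴` inside the big box `{−R..R}⁴` (box coordinates about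
`c`, `2R+1 < n`), the quark indices over the big box split as (abstract cell index × cell label) ⊕ (wall indices), the cell
part being read in cell-relative coordinates. -/
theorem boxIdx_equiv_cells_sum_wall (c : Fin 4 → ℤ) (ℓ R N : ℕ) (hR : 2 * R + 1 < n) (z : Fin N → (Fin 4 → ℤ))
    (hin : ∀ k, ∀ (y : Fin 4 → ℤ), y ∈ box 4 ℓ → z k + y ∈ box 4 R)
    (hdisj : ∀ k k', k ≠ k' → ∀ (y y' : Fin 4 → ℤ), y ∈ box 4 ℓ → y' ∈ box 4 ℓ → z k + y ≠ z k' + y') :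
    ∃ e : {p : TorusSite 4 n × Fin 3 × Fin 4 // ∃ (y : ↥(box 4 R)), Torus.proj n (c + (y : Fin 4 → ℤ)) = p.1} ≃
        ((↥(box 4 ℓ) × Fin 3 × Fin 4) × Fin N) ⊕
        {p : TorusSite 4 n × Fin 3 × Fin 4 //
          (∃ (y : ↥(box 4 R)), Torus.proj n (c + (y : Fin 4 → ℤ)) = p.1) ∧
          ¬ ∃ (k : Fin N) (y : ↥(box 4 ℓ)), Torus.proj n (c + z k + (y : Fin 4 → ℤ)) = p.1},
      (∀ q : (↥(box 4 ℓ) × Fin 3 × Fin 4) × Fin N,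
        ((e.symm (Sum.inl q) : {p : TorusSite 4 n × Fin 3 × Fin 4 //
            ∃ (y : ↥(box 4 R)), Torus.proj n (c + (y : Fin 4 → ℤ)) = p.1}) : TorusSite 4 n × Fin 3 × Fin 4) =
          (Torus.proj n (c + z q.2 + (q.1.1 : Fin 4 → ℤ)), q.1.2.1, q.1.2.2)) ∧
      (∀ w : {p : TorusSite 4 n × Fin 3 × Fin 4 //
          (∃ (y : ↥(box 4 R)), Torus.proj n (c + (y : Fin 4 → ℤ)) = p.1) ∧
          ¬ ∃ (k : Fin N) (y : ↥(box 4 ℓ)), Torus.proj n (c + z k + (y : Fin 4 → ℤ)) = p.1},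
        ((e.symm (Sum.inr w) : {p : TorusSite 4 n × Fin 3 × Fin 4 //
            ∃ (y : ↥(box 4 R)), Torus.proj n (c + (y : Fin 4 → ℤ)) = p.1}) : TorusSite 4 n × Fin 3 × Fin 4) = w.1) := by
  refine indexEquiv_exists_equiv_sum_compl _ _
    (fun q : (↥(box 4 ℓ) × Fin 3 × Fin 4) × Fin N =>
      (Torus.proj n (c + z q.2 + (q.1.1 : Fin 4 → ℤ)), q.1.2.1, q.1.2.2)) ?_ ?_ ?_
  · -- injectivity: unique box coordinates (`hR`) and disjoint cells (`hdisj`)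
    rintro ⟨⟨y, a, s⟩, k⟩ ⟨⟨y', a', s'⟩, k'⟩ h
    simp only [Prod.mk.injEq] at h
    obtain ⟨hproj, rfl, rfl⟩ := h
    have hzy : z k + (y : Fin 4 → ℤ) = z k' + (y' : Fin 4 → ℤ) :=
      wallDecay_boxCoord_unique hR c (hin k _ y.2) (hin k' _ y'.2) (by simpa only [add_assoc] using hproj)
    have hk : k = k' := by
      by_contra hk
      exact hdisj k k' hk _ _ y.2 y'.2 hzy
    subst hk
    have hy : y = y' := Subtype.ext (add_left_cancel hzy)
    subst hy
    rfl
  · -- the cells lie in the big box (`hin`)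
    rintro ⟨⟨y, a, s⟩, k⟩
    exact ⟨⟨z k + (y : Fin 4 → ℤ), hin k _ y.2⟩, (congrArg (Torus.proj n) (add_assoc c (z k) (y : Fin 4 → ℤ))).symm⟩
  · -- the cell indices are exactly the image of the cell parametrisation
    rintro ⟨x, a, s⟩
    constructor
    · rintro ⟨k, y, h⟩
      exact ⟨((y, a, s), k), Prod.ext h rfl⟩
    · rintro ⟨⟨⟨y, a', s'⟩, k⟩, h⟩
      simp only [Prod.mk.injEq] at h
      exact ⟨k, y, h.1⟩

/-- **B2b. Cell-with-collar index split.**  The quark indices over one cell-with-collar `z₀ + {−(ℓ+W)..ℓ+W}⁴` (box coordinates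
about `c`, `2(ℓ+W)+1 < n`) split as (abstract cell index) ⊕ (collar indices). -/
theorem cwcIdx_equiv_cell_sum_collar (c z₀ : Fin 4 → ℤ) (ℓ W : ℕ) (hn : 2 * (ℓ + W) + 1 < n) :
    ∃ e : {p : TorusSite 4 n × Fin 3 × Fin 4 // ∃ (y : ↥(box 4 (ℓ + W))), Torus.proj n (c + z₀ + (y : Fin 4 → ℤ)) = p.1} ≃
        (↥(box 4 ℓ) × Fin 3 × Fin 4) ⊕
        {p : TorusSite 4 n × Fin 3 × Fin 4 //
          (∃ (y : ↥(box 4 (ℓ + W))), Torus.proj n (c + z₀ + (y : Fin 4 → ℤ)) = p.1) ∧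
          ¬ ∃ (y : ↥(box 4 ℓ)), Torus.proj n (c + z₀ + (y : Fin 4 → ℤ)) = p.1},
      (∀ q : ↥(box 4 ℓ) × Fin 3 × Fin 4,
        ((e.symm (Sum.inl q) : {p : TorusSite 4 n × Fin 3 × Fin 4 //
            ∃ (y : ↥(box 4 (ℓ + W))), Torus.proj n (c + z₀ + (y : Fin 4 → ℤ)) = p.1}) : TorusSite 4 n × Fin 3 × Fin 4) =
          (Torus.proj n (c + z₀ + (q.1 : Fin 4 → ℤ)), q.2.1, q.2.2)) ∧
      (∀ w : {p : TorusSite 4 n × Fin 3 × Fin 4 //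
          (∃ (y : ↥(box 4 (ℓ + W))), Torus.proj n (c + z₀ + (y : Fin 4 → ℤ)) = p.1) ∧
          ¬ ∃ (y : ↥(box 4 ℓ)), Torus.proj n (c + z₀ + (y : Fin 4 → ℤ)) = p.1},
        ((e.symm (Sum.inr w) : {p : TorusSite 4 n × Fin 3 × Fin 4 //
            ∃ (y : ↥(box 4 (ℓ + W))), Torus.proj n (c + z₀ + (y : Fin 4 → ℤ)) = p.1}) : TorusSite 4 n × Fin 3 × Fin 4) = w.1) := by
  refine indexEquiv_exists_equiv_sum_compl _ _
    (fun q : ↥(box 4 ℓ) × Fin 3 × Fin 4 => (Torus.proj n (c + z₀ + (q.1 : Fin 4 → ℤ)), q.2.1, q.2.2)) ?_ ?_ ?_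
  · -- injectivity: unique box coordinates about `c + z₀` (`2ℓ+1 < n`)
    rintro ⟨y, a, s⟩ ⟨y', a', s'⟩ h
    simp only [Prod.mk.injEq] at h
    obtain ⟨hproj, rfl, rfl⟩ := h
    have hy : y = y' :=
      Subtype.ext (wallDecay_boxCoord_unique (R := ℓ) (n := n) (by omega) (c + z₀) y.2 y'.2 hproj)
    subst hy
    rfl
  · -- the cell lies in the cell-with-collar
    rintro ⟨y, a, s⟩
    exact ⟨⟨(y : Fin 4 → ℤ), box_mono 4 (Nat.le_add_right ℓ W) y.2⟩, rfl⟩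
  · -- the cell indices are exactly the image of the cell parametrisation
    rintro ⟨x, a, s⟩
    constructor
    · rintro ⟨y, h⟩
      exact ⟨(y, a, s), Prod.ext h rfl⟩
    · rintro ⟨⟨y, a', s'⟩, h⟩
      simp only [Prod.mk.injEq] at h
      exact ⟨y, h.1⟩

end Summit.QuantumFields.QCD.Cruxes.TipPricing.ModularTemplate

end
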